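import Literature.NumberTheory.Automorphic.RamakrishnanTensorProductGL2
import Literature.NumberTheory.Automorphic.RamakrishnanBoxTimes
import Literature.NumberTheory.Automorphic.TunnellOctahedralGlobalProofs
import Literature.NumberTheory.Automorphic.AutomorphicRepsGLSatakeFlathProofs
import HarnessLib

/-!
# Ramakrishnan (2000), Theorem M: the two renderings of "dihedral" and of condition (C), and the
# cuspidality criterion from the cuspidal-case fact

Second sibling proof file (theorems only; no `sorry`, no named fact) of
`Literature.NumberTheory.Automorphic.RamakrishnanTensorProductGL2` — the Theorem M side; the
sibling `RamakrishnanTensorProductGL2Proofs` treats Thm. 4.1.2 — whose named fact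
`Ramakrishnan2000_theoremM` renders D. Ramakrishnan, *Modularity of the Rankin–Selberg `L`-series,
and multiplicity one for `SL(2)`*, Ann. of Math. (2) **152** (2000), 45–111 [Ramakrishnan2000],
**Theorem M** (§3, p. 9 of the held preprint `paper:galaxy-pdf-4279542020`, chunk 12):
*"Let `π, π'` be in `𝒜(2, F)`. Existence: There exists an isobaric automorphic representation
`π ⊠ π'` of `GL(4, 𝔸_F)` satisfying (at every finite place `v`) `L(s, (π ⊠ π')_v) = L(s, π_v × π'_v)`
… Cuspidality Criterion: Suppose `π, π'` are both cuspidal. If neither of them is associated to a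
character of a quadratic extension, then `π ⊠ π'` is cuspidal iff (C) `π'` is not equivalent to
`π ⊗ χ`, for any idele class character `χ` of `F`"* — at the level of Satake parameters almost
everywhere, with "dihedral" rendered as `IsSatakeSelfTwist` (a non-trivial Hecke character `δ` with
`t_{π,v} = δ(ϖ_v) t_{π,v}` a.e.; op. cit. Prop. 2.3.1 (2)) and (C) as `¬ ∃ χ, IsSatakeTwistBy π π' χ`.

The tree holds a second vendoring of the same theorem, `Ramakrishnan2000_boxTimes_cuspidal`
(`RamakrishnanBoxTimes`: Existence + the "if" half of the criterion), in the rendering used by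
`GelbartJacquet_adjoint_lift` / `GelbartJacquet_symmSq_cuspidal`: "non-dihedral" as
`¬ IsQuadraticSelfTwistAE K π` for every quadratic `K/F` (no a.e. self-twist by the sign
`ε_{K/F}(v)`, `quadraticSign`), and (C) as "for no `χ` is `t_{π',v} = χ(ϖ_v) t_{π,v}` whenever both
parameters exist, a.e.".

## What is proved here

* `quadraticHeckeChar_ne_one` — the quadratic Hecke character `ω_{E/F}` of `E = F(√θ)`
  (`quadraticHeckeChar`, the sign character of the index-two subgroup `P_F · N_{E/F} J_E ≤ 𝕀_F`,
  O'Meara 65:21) is not trivial; hence `exists_ne_one_heckeCharacter_quadraticSign`: for a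
  quadratic `E/F` there is a Hecke character `ω ≠ 1` of finite order with `ω(ϖ_v) = ε_{E/F}(v)` at
  almost every `v` (the proof of `exists_heckeCharacter_quadraticSign_of_finrank_eq_two` of
  `TunnellOctahedralGlobalProofs`, Arthur–Clozel Ch. 3 p. 172, keeping track of `ω ≠ 1`).
* `isSatakeSelfTwist_of_isQuadraticSelfTwistAE` — **the two renderings of "dihedral" are
  compatible**: an a.e. self-twist by `ε_{K/F}` (`IsQuadraticSelfTwistAE K π`, `[K : F] = 2`) is a
  non-trivial self-twist by the Hecke character `ω_{K/F}` (`IsSatakeSelfTwist π`); contrapositive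
  `not_isQuadraticSelfTwistAE_of_not_isSatakeSelfTwist` (the hypothesis of Theorem M in the form
  `Ramakrishnan2000_theoremM` implies the one of `Ramakrishnan2000_boxTimes_cuspidal`,
  `GelbartJacquet_adjoint_lift`, `GelbartJacquet_symmSq_cuspidal`).
* `isSatakeTwistBy_iff_eventually_eq_map` — **the two renderings of (C) agree**:
  `IsSatakeTwistBy π π' χ` iff a.e. `t_{π',v} = χ(ϖ_v) t_{π,v}` whenever both Satake parameters
  exist — by the *proved* facts "automorphic representations are unramified almost everywhere"
  and "Satake parameters are unique" (`AutomorphicRepData.hasSatakeParamAt_cofinite_holds`,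
  `hasSatakeParamAt_unique_holds`, Flath 1979 Thm. 3).
* `Ramakrishnan2000_theoremM.exists_cuspidal_of_boxTimes_cuspidal` — **the "if" half of the
  cuspidality criterion of `Ramakrishnan2000_theoremM` (its consequence
  `Ramakrishnan2000_theoremM.exists_cuspidal`) follows from `Ramakrishnan2000_boxTimes_cuspidal`**
  (op. cit. Theorem M with Prop. 3.2.1: "Conversely, suppose that `π, π'` are cuspidal and (C)
  holds … so `π ⊠ π'` must be cuspidal"): the two vendorings overlap in this clause.
* `Ramakrishnan2000_theoremM.of_boxTimes_cuspidal` — the assembly making the residue precise: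
  `Ramakrishnan2000_theoremM` follows from `Ramakrishnan2000_boxTimes_cuspidal` together with
  (R1) the Existence clause for *all* cuspidal pairs (op. cit. Lemma 3.1.1 (II), (III): for a
  dihedral or twist-equivalent pair `π ⊠ π'` is the isobaric, generally non-cuspidal,
  `I_K^F(π_K ⊗ μ)`, resp. `(sym²(π) ⊗ χ) ⊞ ωχ`) and (R2) the "only if" half of the criterion
  (op. cit. §3.2, proof of Prop. 3.2.1, preprint pp. 14–15: "Suppose `π' ≃ π ⊗ χ` … by [JS2] and
  `(L_v)` for almost all `v`, `L^S(s, π ⊠ π' ⊗ (χω)⁻¹)` must have a pole at `s = 1` … Then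
  `π ⊠ π'` cannot be cuspidal"), both stated inline as hypotheses (no new named fact, D-0026).

## Status of the discharge `Ramakrishnan2000_theoremM_holds` (triage: XL — a theory)

The printed proof of Theorem M (op. cit. §3) runs: Lemma 3.1.1 (the special cases (I)–(III) via
isobaric sums, automorphic induction and Gelbart–Jacquet); the converse theorem of
Cogdell–Piatetski-Shapiro for `GL(4)` with a finite exceptional set `T` (Thm. 3.1.3); the local
tensor product `Π = ⊗_v (π_v ⊠ π'_v)` through the local Langlands correspondence for `GL(2)` and
`GL(4)` (§3.1 (P1), Prop. 3.2.1); the triple product `L`-functions `L(s, π × π' × π'')` of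
Garrett, Piatetski-Shapiro–Rallis, Ikeda and Shahidi — meromorphic continuation, functional
equation, entirety after a ramified twist (§3.3, Prop. 3.3.1–3.3.7) and boundedness in vertical
strips by Arthur's truncation of Eisenstein series on `GSp(6)` (§3.4, Prop. 3.4.6–3.4.21); the
resulting modularity for "good" pairs (Thm. 3.5.1); a descent criterion along infinitely many
cyclic extensions of prime degree resting on Arthur–Clozel base change for `GL(4)` (Prop. 3.6.1);
and the assembly of §3.7, with the cuspidality criterion deduced in Prop. 3.2.1 from
Jacquet–Shalika [JS2] and the exterior square `L`-function of `π ⊠ π'`. Of these carriers the tree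
has, as named facts only, Arthur–Clozel's weak base change of cuspidal data
(`ArthurClozel1989_weakLifting_cuspidal`), the Gelbart–Jacquet lift
(`GelbartJacquet_symmSq_automorphic`) and Jacquet–Shalika (2.1)–(2.3) for Borel–Jacquet data
(`JacquetShalika1981_partialPairL_boundary_repData`, `…_pole_repData`, unproved); it has no
converse theorem for `GL(n)`, no triple product (or `GL(4) × GL(2)` Rankin–Selberg) `L`-functions
with their functional equations, no isobaric sums / Eisenstein constituents (Langlands' lemma), no
automorphic induction, and no local components `π_v` of an adelic datum. No instance of the
Existence clause is provable before an automorphic representation of `GL(4, 𝔸_F)` with prescribed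
Hecke eigenvalues can be constructed (the situation of `Kim2003_exteriorSquare_GL4`, see
`KimExteriorSquareGL4Proofs`); (R2) is within reach of the Jacquet–Shalika facts once they are
discharged (with `GL(1)` data attached to Hecke characters, `GLOneOfHeckeCharacterBJ`). Nothing in
this file assumes `Ramakrishnan2000_theoremM`.

## References

* [Ramakrishnan2000] D. Ramakrishnan, *Modularity of the Rankin–Selberg `L`-series, and
  multiplicity one for `SL(2)`*, Ann. of Math. (2) 152 (2000), 45–111, doi:10.2307/2661379:
  Theorem M (§3), Lemma 3.1.1, Thm. 3.1.3, Prop. 2.3.1 (2), Prop. 3.2.1 and its proof, §3.7.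
* [ArthurClozelAMS120] J. Arthur, L. Clozel, *Simple algebras, base change, and the advanced
  theory of the trace formula*, Ann. of Math. Stud. 120 (1989), Ch. 3, proof of Thm. 3.1 (p. 172).
* [Omeara1963] O. T. O'Meara, *Introduction to quadratic forms* (1963), §65D Prop. 65:21,
  §71C Prop. 71:17.
* D. Flath, *Decomposition of representations into tensor products*, Corvallis 1979, Thm. 3.
-/

noncomputable section

open scoped NumberField MatrixGroups Classical
open NumberField IsDedekindDomain Filter Topology

namespace Literature.NumberTheory.Automorphic

open QuadraticForms GaloisRepresentations

/-! ### The quadratic Hecke character is non-trivial -/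

section QuadraticCharacter

variable {F E : Type} [Field F] [NumberField F] [Field E] [NumberField E] [Algebra F E]

/-- **`ω_{E/F} ≠ 1`.** The quadratic Hecke character of `E = F(√θ)` (`θ ∈ 𝓞 F` a non-square) is
the sign character of the subgroup `P_F · N_{E/F} J_E` of index two in `𝕀_F` (O'Meara 65:21,
`index_principalIdeles_sup_normIdeles`), so it takes the value `-1` at any idèle outside that
subgroup. [cite: Omeara1963, §65D Prop. 65:21] -/
theorem quadraticHeckeChar_ne_one {θ : 𝓞 F} (hθ : ¬ IsSquare (θ : F)) :
    quadraticHeckeChar F θ hθ ≠ 1 := by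
  intro h
  have hne : (principalIdeles F ⊔ normIdeles F (θ : F)) ≠ ⊤ := by
    intro htop
    have hidx := index_principalIdeles_sup_normIdeles F (θ : F) hθ
    rw [htop, Subgroup.index_top] at hidx
    exact absurd hidx (by norm_num)
  obtain ⟨x, hx⟩ : ∃ x, x ∉ principalIdeles F ⊔ normIdeles F (θ : F) := by
    by_contra hall
    push Not at hall
    exact hne ((Subgroup.eq_top_iff' _).mpr hall)
  have h1 := quadraticHeckeChar_apply_of_not_mem hθ hx
  rw [h, HeckeCharacter.one_apply] at h1
  have h1' : ((1 : ℂˣ) : ℂ) = ((-1 : ℂˣ) : ℂ) := congrArg Units.val h1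
  norm_num at h1'

/-- **The quadratic Hecke character `ω_{E/F} ≠ 1` with prescribed values at uniformizers.** For a
quadratic extension `E/F` of number fields there is a Hecke character `ω ≠ 1` of `F` of finite
order such that, at almost every finite place `v` (namely `v ∤ 2θ` unramified in `E`, for
`E = F(√θ)`, `θ ∈ 𝓞 F`), `ω` is unramified and `ω(ϖ_v) = ε_{E/F}(v)` (`quadraticSign`: `+1` at the
split, `-1` at the inert places). This is `exists_heckeCharacter_quadraticSign_of_finrank_eq_two`
(`TunnellOctahedralGlobalProofs`: `ω = quadraticHeckeChar F θ`, O'Meara 65:21 and 71:17 at the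
tame places) with the non-triviality `quadraticHeckeChar_ne_one` recorded — Arthur–Clozel's
"`η` … the character of `𝔸_F^×` vanishing exactly on `F^* N(𝔸_E^*)` … `ζ_v = η(ϖ_v)` is a root of
unity of order `f_v`". [cite: ArthurClozelAMS120, Ch. 3, proof of Thm. 3.1 (p. 172)]
[cite: Omeara1963, §65D Prop. 65:21 and §71C Prop. 71:17] -/
theorem exists_ne_one_heckeCharacter_quadraticSign (h2 : Module.finrank F E = 2) :
    ∃ ω : HeckeCharacter F, ω ≠ 1 ∧ ω.IsFiniteOrder ∧
      ∀ᶠ v : HeightOneSpectrum (𝓞 F) in Filter.cofinite,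
        ω.IsUnramifiedAt v ∧ ω.valueAtUniformizer v = quadraticSign E v := by
  classical
  haveI : FiniteDimensional F E := Module.finite_of_finrank_eq_succ h2
  haveI : Algebra.IsQuadraticExtension F E := ⟨h2⟩
  haveI : IsGalois F E := inferInstance
  have hprime : (Module.finrank F E).Prime := by rw [h2]; exact Nat.prime_two
  -- `E = F(√θ)`, `θ ∈ 𝓞 F` a non-square
  obtain ⟨θ, α, hθ0, hα, hαF⟩ := exists_integer_sq_eq_of_finrank_eq_two h2
  have hθ : ¬ IsSquare (θ : F) := QuadraticForms.not_isSquare_of_sq_eq hα hαF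
  refine ⟨quadraticHeckeChar F θ hθ, quadraticHeckeChar_ne_one hθ,
    isFiniteOrder_quadraticHeckeChar hθ, ?_⟩
  -- almost every `v`: `v ∤ 2θ` and `v` unramified in `E`
  have hS : ∀ᶠ v : HeightOneSpectrum (𝓞 F) in cofinite,
      θ ∉ v.asIdeal ∧ (2 : 𝓞 F) ∉ v.asIdeal := by
    have h := ((finite_setOf_mem_asIdeal F hθ0).union
      (finite_setOf_mem_asIdeal F (two_ne_zero (α := 𝓞 F)))).compl_mem_cofinite
    filter_upwards [h] with v hv
    simpa only [Set.mem_compl_iff, Set.mem_union, Set.mem_setOf_eq, not_or] using hv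
  have hunrE : ∀ᶠ v : HeightOneSpectrum (𝓞 F) in cofinite,
      Algebra.IsUnramifiedIn (𝓞 E) v.asIdeal := by
    rw [Filter.eventually_cofinite]
    exact finite_setOf_not_isUnramifiedIn F E
  filter_upwards [hS, hunrE] with v hv hvE
  refine ⟨isUnramifiedAt_quadraticHeckeChar hθ hv.2 hv.1, ?_⟩
  have hcard : Nat.card {w : HeightOneSpectrum (𝓞 E) // w.under (𝓞 F) = v} =
      (finitePlacesOver E v).ncard :=
    Nat.card_coe_set_eq (finitePlacesOver E v)
  unfold quadraticSign
  by_cases hsq : IsSquare (algebraMap F (v.adicCompletion F) (θ : F))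
  · -- `v` splits: `ω(ϖ_v) = 1 = ε`
    rw [valueAtUniformizer_quadraticHeckeChar_of_isSquare hθ hsq]
    have h2pl : (finitePlacesOver E v).ncard = 2 :=
      (QuadraticExtension.ncard_finitePlacesOver_eq_two_iff_isSquare hα hαF v).2 hsq
    rcases placesOver_dichotomy_of_prime hprime hvE with ⟨-, hsplit⟩ | ⟨h1, -⟩
    · obtain ⟨w₀, hw₀⟩ := exists_above (E := E) v
      rw [if_pos ⟨w₀, hw₀, hsplit w₀ (HeightOneSpectrum.ext hw₀)⟩]
    · rw [hcard, h2pl] at h1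
      exact absurd h1 (by norm_num)
  · -- `v` is inert: `ω(ϖ_v) = -1 = ε` by 71:17 at the tame place `v`
    have h1pl : (finitePlacesOver E v).ncard = 1 :=
      (QuadraticExtension.ncard_finitePlacesOver_eq_one_iff_not_isSquare hα hαF v).2 hsq
    rw [valueAtUniformizer_quadraticHeckeChar_of_not_le hθ hv.2 hv.1
      (QuadraticForms.not_range_localUnits_le_of_not_isSquare hα hαF hv.2 hv.1 hvE hsq)]
    rcases placesOver_dichotomy_of_prime hprime hvE with ⟨h2', -⟩ | ⟨-, hinert⟩
    · rw [hcard, h1pl, h2] at h2'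
      exact absurd h2' (by norm_num)
    · rw [if_neg]
      rintro ⟨w, hw, hfw⟩
      rw [hinert w (HeightOneSpectrum.ext hw), h2] at hfw
      exact absurd hfw (by norm_num)

end QuadraticCharacter

/-! ### The two renderings of "dihedral" -/

section Dihedral

variable {F : Type} [Field F] [NumberField F] {hF : isCompact_glFiniteIntegralLevel 2 F}

/-- **An a.e. self-twist by `ε_{K/F}` is a non-trivial self-twist by a Hecke character.** If
`[K : F] = 2` and the Satake parameters of `π` (on `GL(2)/F`) are a.e. stable under
`ε_{K/F}(v)` (`IsQuadraticSelfTwistAE K π`, the tree's rendering of "`π ≅ π ⊗ η_{K/F}`, `π` is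
monomial"), then `π` admits the non-trivial self-twist `ω_{K/F}` (`IsSatakeSelfTwist π`, the
rendering of "dihedral" in `Ramakrishnan2000_theoremM`): `ω_{K/F} ≠ 1` and
`ω_{K/F}(ϖ_v) = ε_{K/F}(v)` for almost all `v` (`exists_ne_one_heckeCharacter_quadraticSign`).
Ramakrishnan 2000, Prop. 2.3.1 (2): "The image of `I_{K/F}` consists precisely of those `π` …
such that `π ≃ π ⊗ χ`" (`χ` the idele class character of `K/F`). [cite: Ramakrishnan2000, Prop. 2.3.1 (2)]
[cite: ArthurClozelAMS120, Ch. 3, proof of Thm. 3.1 (p. 172)] -/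
theorem isSatakeSelfTwist_of_isQuadraticSelfTwistAE (K : Type) [Field K] [NumberField K]
    [Algebra F K] (hK : Module.finrank F K = 2)
    {π : AutomorphicRepData (AutomorphyDatum.gl 2 F hF)} (h : IsQuadraticSelfTwistAE K π) :
    IsSatakeSelfTwist π := by
  obtain ⟨ω, hω1, -, hω⟩ := exists_ne_one_heckeCharacter_quadraticSign (F := F) (E := K) hK
  refine ⟨ω, hω1, ?_⟩
  filter_upwards [h, hω] with v hv hωv α hα
  have hfix := hv α hα
  rw [hωv.2, hfix]
  exact hα

/-- **Contrapositive form**: a cuspidal `π` on `GL(2)/F` without non-trivial self-twists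
(`¬ IsSatakeSelfTwist π`, "not dihedral" in `Ramakrishnan2000_theoremM`) is, for every quadratic
`K/F`, not an a.e. self-twist by `ε_{K/F}` — the hypothesis of `Ramakrishnan2000_boxTimes_cuspidal`,
`GelbartJacquet_adjoint_lift` and `GelbartJacquet_symmSq_cuspidal`.
[cite: Ramakrishnan2000, Prop. 2.3.1 (2)] -/
theorem not_isQuadraticSelfTwistAE_of_not_isSatakeSelfTwist
    {π : AutomorphicRepData (AutomorphyDatum.gl 2 F hF)} (h : ¬ IsSatakeSelfTwist π)
    (K : Type) [Field K] [NumberField K] [Algebra F K] (hK : Module.finrank F K = 2) :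
    ¬ IsQuadraticSelfTwistAE K π :=
  fun hq => h (isSatakeSelfTwist_of_isQuadraticSelfTwistAE K hK hq)

end Dihedral

/-! ### The two renderings of condition (C) -/

section ConditionC

variable {n : ℕ} {F : Type} [Field F] [NumberField F] {hF : isCompact_glFiniteIntegralLevel n F}

/-- **(C) in the two vendorings.** `π'` is the twist `π ⊗ χ` at the level of Satake parameters
(`IsSatakeTwistBy π π' χ`: a.e., every Satake parameter `α` of `π` at `v` gives the Satake
parameter `χ(ϖ_v) α` of `π'`) iff a.e. `β = χ(ϖ_v) α` for all Satake parameters `α` of `π` and `β`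
of `π'` at `v` (the form negated in `Ramakrishnan2000_boxTimes_cuspidal`). (⇒) by the uniqueness of
Satake parameters, (⇐) because `π'` is unramified at almost every place — both *proved* in the
tree (`AutomorphicRepData.hasSatakeParamAt_unique_holds`, `hasSatakeParamAt_cofinite_holds`;
Flath 1979, Thm. 3). [cite: FlathCorvallis1979, Thm. 3] -/
theorem isSatakeTwistBy_iff_eventually_eq_map (π π' : AutomorphicRepData (AutomorphyDatum.gl n F hF))
    (χ : HeckeCharacter F) :
    IsSatakeTwistBy π π' χ ↔
      ∀ᶠ v : HeightOneSpectrum (𝓞 F) in Filter.cofinite, ∀ α β : Multiset ℂ,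
        π.HasSatakeParamAt v α → π'.HasSatakeParamAt v β →
          β = α.map (χ.valueAtUniformizer v * ·) := by
  constructor
  · intro h
    filter_upwards [h] with v hv α β hα hβ
    exact π'.hasSatakeParamAt_unique_holds hβ (hv α hα)
  · intro h
    have hcof : ∀ᶠ v : HeightOneSpectrum (𝓞 F) in Filter.cofinite, π'.IsUnramifiedAt v :=
      π'.hasSatakeParamAt_cofinite_holds
    filter_upwards [h, hcof] with v hv hv' α hα
    obtain ⟨β, hβ⟩ := hv'
    rw [← hv α β hα hβ]
    exact hβ

/-- The (⇐) half of `isSatakeTwistBy_iff_eventually_eq_map`, in the form used below.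
[cite: FlathCorvallis1979, Thm. 3] -/
theorem isSatakeTwistBy_of_eventually_eq_map {π π' : AutomorphicRepData (AutomorphyDatum.gl n F hF)}
    {χ : HeckeCharacter F}
    (h : ∀ᶠ v : HeightOneSpectrum (𝓞 F) in Filter.cofinite, ∀ α β : Multiset ℂ,
      π.HasSatakeParamAt v α → π'.HasSatakeParamAt v β →
        β = α.map (χ.valueAtUniformizer v * ·)) :
    IsSatakeTwistBy π π' χ :=
  (isSatakeTwistBy_iff_eventually_eq_map π π' χ).mpr h

end ConditionC

/-! ### The cuspidality criterion ("if" half) from `Ramakrishnan2000_boxTimes_cuspidal` -/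

section Criterion

variable {F : Type} [Field F] [NumberField F]

/-- **The "if" half of the cuspidality criterion of Theorem M from the cuspidal-case fact.**
Granting `Ramakrishnan2000_boxTimes_cuspidal` (Theorem M, Existence + "if" half, in the
`IsQuadraticSelfTwistAE` rendering): two cuspidal `π, π'` on `GL(2)/F` without non-trivial
self-twists (`¬ IsSatakeSelfTwist`) which are not twists of each other
(`¬ ∃ χ, IsSatakeTwistBy π π' χ`, condition (C)) have a **cuspidal** `Π` on `GL(4)/F` with Satake
parameters `{αᵢ βⱼ}` almost everywhere — the statement `Ramakrishnan2000_theoremM.exists_cuspidal`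
without assuming `Ramakrishnan2000_theoremM`. (Ramakrishnan 2000, Theorem M with Prop. 3.2.1:
"Conversely, suppose that `π, π'` are cuspidal and (C) holds … `π ⊠ π'` must be cuspidal".)
[cite: Ramakrishnan2000, Theorem M (§3) and Prop. 3.2.1] -/
theorem Ramakrishnan2000_theoremM.exists_cuspidal_of_boxTimes_cuspidal
    (h : Ramakrishnan2000_boxTimes_cuspidal)
    (h2 : isCompact_glFiniteIntegralLevel 2 F) (h4 : isCompact_glFiniteIntegralLevel 4 F)
    (π π' : CuspidalAutomorphicRepData 2 F h2) (hπ : ¬ IsSatakeSelfTwist π.1)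
    (hπ' : ¬ IsSatakeSelfTwist π'.1)
    (hC : ¬ ∃ χ : HeckeCharacter F, IsSatakeTwistBy π.1 π'.1 χ) :
    ∃ P : CuspidalAutomorphicRepData 4 F h4,
      ∀ᶠ v : HeightOneSpectrum (𝓞 F) in Filter.cofinite, ∀ α β : Multiset ℂ,
        π.1.HasSatakeParamAt v α → π'.1.HasSatakeParamAt v β →
          P.1.HasSatakeParamAt v (satakeTensor α β) :=
  h F h2 h4 π π'
    (fun K _ _ _ hK => ⟨not_isQuadraticSelfTwistAE_of_not_isSatakeSelfTwist hπ K hK,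
      not_isQuadraticSelfTwistAE_of_not_isSatakeSelfTwist hπ' K hK⟩)
    (fun χ hχ => hC ⟨χ, isSatakeTwistBy_of_eventually_eq_map hχ⟩)

/-- **Assembly: what separates the two vendorings.** `Ramakrishnan2000_theoremM` follows from
`Ramakrishnan2000_boxTimes_cuspidal` together with the two clauses of Theorem M that the latter
does not carry, stated here inline as hypotheses (no named fact is introduced): (R1) the
**Existence** of an automorphic (possibly non-cuspidal) `Π` on `GL(4)/F` with `t_Π = t_π ⊗ t_π'`
a.e. for *every* cuspidal pair — op. cit. Lemma 3.1.1 (II), (III): for a dihedral or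
twist-equivalent pair `π ⊠ π'` is the isobaric `I_K^F(π_K ⊗ μ)`, resp. `(sym²(π) ⊗ χ) ⊞ ωχ`
(automorphic induction and isobaric sums, absent from the tree) — and (R2) the **"only if"** half
of the criterion — op. cit. proof of Prop. 3.2.1: "Suppose `π' ≃ π ⊗ χ` … by [JS2] and `(L_v)` for
almost all `v`, `L^S(s, π ⊠ π' ⊗ (χω)⁻¹)` must have a pole at `s = 1` … Then `π ⊠ π'` cannot be
cuspidal" (Jacquet–Shalika (2.2)–(2.3), in the tree the unproved
`JacquetShalika1981_partialPairL_boundary_repData`, `…_pole_repData`).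
[cite: Ramakrishnan2000, Theorem M (§3), Lemma 3.1.1 and Prop. 3.2.1] -/
theorem Ramakrishnan2000_theoremM.of_boxTimes_cuspidal (h : Ramakrishnan2000_boxTimes_cuspidal)
    (hR1 : ∀ (F : Type) [Field F] [NumberField F]
      (h2 : isCompact_glFiniteIntegralLevel 2 F) (h4 : isCompact_glFiniteIntegralLevel 4 F)
      (π π' : CuspidalAutomorphicRepData 2 F h2),
      ∃ P : AutomorphicRepData (AutomorphyDatum.gl 4 F h4),
        ∀ᶠ v : HeightOneSpectrum (𝓞 F) in Filter.cofinite, ∀ α β : Multiset ℂ,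
          π.1.HasSatakeParamAt v α → π'.1.HasSatakeParamAt v β →
            P.HasSatakeParamAt v (satakeTensor α β))
    (hR2 : ∀ (F : Type) [Field F] [NumberField F]
      (h2 : isCompact_glFiniteIntegralLevel 2 F) (h4 : isCompact_glFiniteIntegralLevel 4 F)
      (π π' : CuspidalAutomorphicRepData 2 F h2) (χ : HeckeCharacter F),
      IsSatakeTwistBy π.1 π'.1 χ →
        ¬ ∃ P : CuspidalAutomorphicRepData 4 F h4,
          ∀ᶠ v : HeightOneSpectrum (𝓞 F) in Filter.cofinite, ∀ α β : Multiset ℂ,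
            π.1.HasSatakeParamAt v α → π'.1.HasSatakeParamAt v β →
              P.1.HasSatakeParamAt v (satakeTensor α β)) :
    Ramakrishnan2000_theoremM := by
  intro F _ _ h2 h4 π π'
  refine ⟨hR1 F h2 h4 π π', fun hπ hπ' => ⟨?_, ?_⟩⟩
  · rintro hP ⟨χ, hχ⟩
    exact hR2 F h2 h4 π π' χ hχ hP
  · exact Ramakrishnan2000_theoremM.exists_cuspidal_of_boxTimes_cuspidal h h2 h4 π π' hπ hπ'

end Criterion

end Literature.NumberTheory.Automorphic

end
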